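import Summits.QuantumFields.YangMills.Theorems.ColdStartUniversalityColdStartSolutionsExistCoordMartingale
import Literature.Probability.Process.ItoIntegralLinearity
import Literature.Probability.Process.SimpleProcessProduct
import Literature.Probability.Process.SimpleIntegralMartingale
import Literature.Probability.Process.ItoFormulaCore
import HarnessLib

/-!
# Route `ColdStartUniversality`, support item S (stmt-QuantumFields-24811), line `piwiener`:
# stub B tools I — elementary integrals as Itô integrals; Riemann–Stieltjes sums against `L²` martingales

Helper file (lead `ym-line-csu-p1`) for stub B `stub_frobeniusNormPreserved` (sphere preservation for tame
tangent link SDEs).  The proof of B is a direct quadratic-variation computation on dyadic grids (exact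
second-order Taylor expansion of `y ↦ y²`, tangency identities kill the limiting integrands); its stochastic
inputs are generic facts about the tree's characterised Itô integral (`IsItoIntegral`, arbitrary filtered
probability space, integrator `B` a continuous square-integrable martingale with `B² − t` a martingale):

* `simple_isItoIntegral_self` — **an elementary integral `K·B` IS an Itô integral of the step
  process `K`** (so that Doob–Itô bounds compare `∫ H dB` with `K·B`: `lintegral_iSup_sub_simple_sq_le`);
* `simple_integral_sq_le_of_martingale` — **`E[(K·M)_t²] ≤ C² E[M_t²]`** for a bounded
  simple `K` (`|Kᵢ| ≤ C`) and ANY square-integrable martingale `M` (orthogonal increments), the bound behind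
  "Riemann sums with bounded predictable weights of a small martingale are small".

No definition, no sorry.  RECORD-rung plumbing; nothing here bears on the Yang–Mills mass gap. -/

set_option autoImplicit false

noncomputable section

namespace Summit.QuantumFields.YangMills.Theorems.ColdStartUniversality

open MeasureTheory ProbabilityTheory Filter Topology Finset
open scoped NNReal ENNReal BigOperators
open Literature.Probability.Process

variable {Ω : Type*} {m : MeasurableSpace Ω} {𝓕 : Filtration ℝ≥0 m} {μ : Measure Ω}

/-- The constant sequence `K, K, K, …` approximates the step process of `K` (zero error). [folklore] -/
theorem simple_isApproxSeq_const (K : SimpleProcess m 𝓕) :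
    SimpleProcess.IsApproxSeq (fun _ => K) K.toProcess μ := by
  intro t ε hε
  have hset : ∀ n : ℕ, {ω | ENNReal.ofReal ε ≤ ∫⁻ s in Set.Icc (0 : ℝ) t,
      ENNReal.ofReal ((((fun _ : ℕ => K) n).toProcess s.toNNReal ω - K.toProcess s.toNNReal ω) ^ 2)} = ∅ := by
    intro n
    ext ω
    simp only [sub_self, ne_eq, OfNat.ofNat_ne_zero, not_false_eq_true, zero_pow, ENNReal.ofReal_zero,
      lintegral_zero, nonpos_iff_eq_zero, ENNReal.ofReal_eq_zero, not_le, Set.mem_setOf_eq,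
      Set.mem_empty_iff_false, iff_false]
    exact hε
  refine tendsto_const_nhds.congr' (Eventually.of_forall fun n => ?_)
  beta_reduce
  rw [hset n, measure_empty]

/-- **The step process of a simple process is progressively measurable**: on `[0, u] × Ω` each term
`1_{(tᵢ, tᵢ₊₁]}(t) · Kᵢ(ω)` is either `𝓑 ⊗ 𝓕 u`-measurable (`tᵢ ≤ u`) or identically zero (`u < tᵢ`).
[folklore] -/
theorem simple_isStronglyProgressive_toProcess (K : SimpleProcess m 𝓕) : IsStronglyProgressive 𝓕 K.toProcess := by
  intro u
  letI mprod : MeasurableSpace (Set.Iic u × Ω) := Subtype.instMeasurableSpace.prod (𝓕 u)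
  have hfst : Measurable fun p : Set.Iic u × Ω => ((p.1 : ℝ≥0)) := measurable_subtype_coe.comp measurable_fst
  have heq : (fun p : Set.Iic u × Ω => K.toProcess p.1 p.2) = fun p => ∑ i ∈ range (K.times.length - 1),
      (if ((p.1 : ℝ≥0)) ∈ Set.Ioc (K.time i) (K.time (i + 1)) then K.value i p.2 else 0) := by
    funext p
    simp only [SimpleProcess.toProcess, Set.indicator_apply]
  rw [heq]
  refine (Finset.measurable_sum _ fun i hi => ?_).stronglyMeasurable
  have hi' : i < K.times.length := by have := Finset.mem_range.1 hi; omega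
  by_cases hiu : K.time i ≤ u
  · have hv : Measurable[𝓕 u] (K.value i) := ((K.stronglyMeasurable_value hi').mono (𝓕.mono hiu)).measurable
    exact Measurable.ite (hfst measurableSet_Ioc) (hv.comp measurable_snd) measurable_const
  · have hzero : (fun p : Set.Iic u × Ω => if ((p.1 : ℝ≥0)) ∈ Set.Ioc (K.time i) (K.time (i + 1)) then
        K.value i p.2 else 0) = fun _ => 0 := by
      funext p
      rw [if_neg]
      rintro ⟨h1, -⟩
      exact hiu (h1.le.trans p.1.2)
    rw [hzero]
    exact measurable_const

/-- **An elementary stochastic integral is an Itô integral of its step process**: for a bounded simple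
process `K` and a continuous square-integrable martingale `B` with `B_t² − t` a martingale,
`IsItoIntegral K.toProcess B (K·B)`; moreover `K·B` is a square-integrable martingale.
Revuz–Yor (1999), Ch. IV, (2.4) and Prop. (2.13). [cite: RevuzYor1999, Ch. IV Prop. (2.13)] -/
theorem simple_isItoIntegral_self [IsProbabilityMeasure μ] (K : SimpleProcess m 𝓕)
    {B : ℝ≥0 → Ω → ℝ} (hB : Martingale B 𝓕 μ) (hBsq : Martingale (fun t ω => B t ω ^ 2 - (t : ℝ)) 𝓕 μ)
    (hB2 : ∀ t, MemLp (B t) 2 μ) (hBc : ∀ ω, Continuous (B · ω)) :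
    IsItoIntegral K.toProcess B (K.integral B) 𝓕 μ ∧ Martingale (K.integral B) 𝓕 μ ∧
      ∀ t, MemLp (K.integral B t) 2 μ := by
  have hM : Martingale (K.integral B) 𝓕 μ := K.martingale_integral hB
  have hpath : ∀ ω, Measurable fun s : ℝ => K.toProcess s.toNNReal ω := fun ω =>
    K.measurable_toProcess_prod.comp measurable_prodMk_left
  refine ⟨⟨fun ω => K.integral_zero B ω, ae_of_all _ fun ω => K.continuous_integral (hBc ω),
    hM.isLocalMartingale, ⟨fun _ => K, simple_isApproxSeq_const K⟩, fun Gn hGn t ε hε => ?_⟩, hM,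
    fun t => K.memLp_integral hB2 t⟩
  exact tendsto_measure_integral_sub_of_isApproxSeq hGn (simple_isApproxSeq_const K) hpath hB hBsq hB2 hBc t hε

/-- **Doob–Itô bound against an elementary integral**: for `J = ∫ H dB` (`H` progressive) and a bounded
simple `K`, `E[sup_{s≤t} (J_s − (K·B)_s)²] ≤ 4 E ∫₀ᵗ (H_s − K_s)² ds`. [folklore] -/
theorem lintegral_iSup_sub_simple_sq_le [IsProbabilityMeasure μ] {B H J : ℝ≥0 → Ω → ℝ}
    (hB : Martingale B 𝓕 μ) (hBsq : Martingale (fun t ω => B t ω ^ 2 - (t : ℝ)) 𝓕 μ)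
    (hB2 : ∀ t, MemLp (B t) 2 μ) (hBc : ∀ ω, Continuous (B · ω))
    (hH : IsStronglyProgressive 𝓕 H) (hJ : IsItoIntegral H B J 𝓕 μ) (K : SimpleProcess m 𝓕) (t : ℝ≥0) :
    ∫⁻ ω, ⨆ s ∈ Set.Iic t, ENNReal.ofReal ((J s ω - K.integral B s ω) ^ 2) ∂μ ≤
      4 * ∫⁻ ω, (∫⁻ s in Set.Icc (0 : ℝ) t,
        ENNReal.ofReal ((H s.toNNReal ω - K.toProcess s.toNNReal ω) ^ 2)) ∂μ :=
  IsItoIntegral.lintegral_iSup_sub_sq_le hB hBsq hB2 hBc hH (simple_isStronglyProgressive_toProcess K) hJ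
    (simple_isItoIntegral_self K hB hBsq hB2 hBc).1 t

/-- **Riemann–Stieltjes sums with bounded predictable weights against an `L²` martingale**:
`E[(K·M)_t²] ≤ C² · E[M_t²]` for a simple process `K` with `|Kᵢ| ≤ C` and a square-integrable
martingale `M` (orthogonality of the summands, `E[(M_b − M_a)²] = E[M_b²] − E[M_a²]`, telescoping).
Revuz–Yor (1999), Ch. IV, proof of Thm (2.2). [folklore] -/
theorem simple_integral_sq_le_of_martingale [IsProbabilityMeasure μ] (K : SimpleProcess m 𝓕)
    {M : ℝ≥0 → Ω → ℝ} (hM : Martingale M 𝓕 μ) (hM2 : ∀ t, MemLp (M t) 2 μ) {C : ℝ}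
    (hC : ∀ i ω, |K.value i ω| ≤ C) (t : ℝ≥0) :
    ∫ ω, (K.integral M t ω) ^ 2 ∂μ ≤ C ^ 2 * ∫ ω, (M t ω) ^ 2 ∂μ := by
  simp_rw [K.integral_apply_eq_sum_summand M t]
  -- induction over prefixes: `E[(Σ_{i<n} Yᵢ)²] + C² E[M_{t∧t₀}²] ≤ C² E[M_{t∧tₙ}²]`
  have key : ∀ n, n + 1 ≤ K.times.length →
      ∫ ω, (∑ i ∈ range n, K.summand M i t ω) ^ 2 ∂μ + C ^ 2 * ∫ ω, (M (min t (K.time 0)) ω) ^ 2 ∂μ ≤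
        C ^ 2 * ∫ ω, (M (min t (K.time n)) ω) ^ 2 ∂μ := by
    intro n hn
    induction n with
    | zero => simp
    | succ n ih =>
      have ih' := ih (by omega)
      have hsumL2 : MemLp (∑ i ∈ range n, K.summand M i t) 2 μ := K.memLp_sum_summand hM2 (by omega) t
      have hYL2 : MemLp (K.summand M n t) 2 μ := K.memLp_summand hM2 n (by omega) t
      have horth : ∫ ω, (∑ i ∈ range n, K.summand M i t) ω * K.summand M n t ω ∂μ = 0 :=
        K.integral_sum_summand_mul_summand hM hM2 (by omega) t
      -- expand the square
      have hA : Integrable (fun ω => (∑ i ∈ range n, K.summand M i t ω) ^ 2) μ := by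
        have h := hsumL2.integrable_sq
        refine h.congr (ae_of_all _ fun ω => ?_)
        simp only [Finset.sum_apply]
      have hB : Integrable (fun ω => (∑ i ∈ range n, K.summand M i t) ω * K.summand M n t ω) μ :=
        hsumL2.integrable_mul hYL2
      have hCY : Integrable (fun ω => (K.summand M n t ω) ^ 2) μ := hYL2.integrable_sq
      have hexp : ∫ ω, (∑ i ∈ range (n + 1), K.summand M i t ω) ^ 2 ∂μ =
          ∫ ω, (∑ i ∈ range n, K.summand M i t ω) ^ 2 ∂μ + ∫ ω, (K.summand M n t ω) ^ 2 ∂μ := by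
        have h1 : ∀ ω, (∑ i ∈ range (n + 1), K.summand M i t ω) ^ 2 =
            ((∑ i ∈ range n, K.summand M i t ω) ^ 2 + 2 * ((∑ i ∈ range n, K.summand M i t) ω * K.summand M n t ω)) +
              (K.summand M n t ω) ^ 2 := by
          intro ω
          rw [Finset.sum_range_succ, Finset.sum_apply]
          ring
        have hB2 : Integrable (fun ω => 2 * ((∑ i ∈ range n, K.summand M i t) ω * K.summand M n t ω)) μ :=
          hB.const_mul 2
        have hAB : Integrable (fun ω => (∑ i ∈ range n, K.summand M i t ω) ^ 2 +
            2 * ((∑ i ∈ range n, K.summand M i t) ω * K.summand M n t ω)) μ := hA.add hB2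
        simp_rw [h1]
        rw [integral_add hAB hCY, integral_add hA hB2, integral_const_mul, horth]
        ring
      -- the last summand: `E[Yₙ²] ≤ C² (E[M_{t∧tₙ₊₁}²] − E[M_{t∧tₙ}²])`
      have hab : min t (K.time n) ≤ min t (K.time (n + 1)) :=
        min_le_min le_rfl (K.time_mono (Nat.le_succ n) (by omega))
      have hincr := integral_sub_sq_of_martingale hM hM2 hab
      have hY : ∫ ω, (K.summand M n t ω) ^ 2 ∂μ ≤
          C ^ 2 * (∫ ω, (M (min t (K.time (n + 1))) ω) ^ 2 ∂μ - ∫ ω, (M (min t (K.time n)) ω) ^ 2 ∂μ) := by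
        rw [← hincr, ← integral_const_mul]
        refine integral_mono hYL2.integrable_sq (((hM2 _).sub (hM2 _)).integrable_sq.const_mul _) fun ω => ?_
        simp only [SimpleProcess.summand_apply]
        rw [mul_pow]
        refine mul_le_mul_of_nonneg_right ?_ (sq_nonneg _)
        rw [← sq_abs]
        exact pow_le_pow_left₀ (abs_nonneg _) (hC n ω) 2
      rw [hexp]
      linarith
  rcases Nat.eq_zero_or_pos K.times.length with h0 | hpos
  · simp only [h0, Nat.zero_sub, Finset.range_zero, Finset.sum_empty, ne_eq, OfNat.ofNat_ne_zero,
      not_false_eq_true, zero_pow, integral_zero]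
    positivity
  · have h := key (K.times.length - 1) (by omega)
    have hmono : ∫ ω, (M (min t (K.time (K.times.length - 1))) ω) ^ 2 ∂μ ≤ ∫ ω, (M t ω) ^ 2 ∂μ :=
      integral_sq_mono_of_martingale hM hM2 (min_le_left _ _)
    have hnn : 0 ≤ C ^ 2 * ∫ ω, (M (min t (K.time 0)) ω) ^ 2 ∂μ := by positivity
    nlinarith [mul_le_mul_of_nonneg_left hmono (sq_nonneg C)]

end Summit.QuantumFields.YangMills.Theorems.ColdStartUniversality

end
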